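import Mathlib
import Literature.AlgebraicGeometry.Resolution.LocalBlowup
import Summits.ResolutionOfSingularities.ResolutionOfSingularities.Theorems.RadicialJungCleanModelsCleanPatchingDefs
import HarnessLib

/-!
# Crux `DescentPerfectToAll` (stmt-ResolutionOfSingularities-0549) — NEGATION lens 6, generation 6 (res-B-lens-6 g6, 2026-08-29)
# The two-sided normal form of the strict clean forms (2)/(3), and the typed record of the g6 negation audit.

bears_on: LADDER-RESOLUTION:B · [OURS · CANDIDATE] counted 0 · nothing here proves resolution in characteristic `p`
(resolution in char `p` is NOT proved; rung B = `PerfectRes_p → ResolutionInChar p` stays open) · Hironaka 2017 is never cited as fact.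

This file is a WORKFILE (not a line: it does not conclude the crux).  Kernel content (§1, no `sorry`):

* `form2_or_form3_iff` — for a local ring `R` of characteristic `p` and `G = f s` read through any ring map `f : R → F`:
  «`G` has loose clean form (2) or (3) at `R`»  ⟺  «some preimage `s` of `G` satisfies `s - c^p ∉ 𝔪²` for EVERY `c : R`»,
  i.e. `s ∉ R^p + 𝔪²`.  The point used in the memo `NEGATION-lens6-g6.md` §2: the case analysis «is the residue of the unit a
  `p`-th power of the (possibly inseparable, possibly grown) residue field `κ_N` or not» that the class-(A) arc proofs carry
  (`CLASSA-rational-arcs-lens5.md` §7, coefficient-field bookkeeping) is UNNECESSARY for the conclusion: one test decides, and the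
  dichotomy form (2) / form (3) is automatic (`form2_or_form3_of_forall_sub_pow_not_mem_sq`).  Over a regular local ring essentially of
  finite type over a field the test is `ds ⊗ 1 ≠ 0` in `Ω_{R/𝔽_p} ⊗ κ` (Matsumura, CRT Thm 25.2 — not needed and not used here); the lead's
  `Theorems.RadicialJung.CleanModels.not_mem_sq_of_derivation` is the derivation form of the same test for NON-units, and g5's
  `NegationLens6g5.form3_iff_of_mem` is the `δ`-class half (re-proved inline below because crux workfiles are not importable).
* `looseCleanForm_of_forall_sub_pow_not_mem_sq` — the same, packaged as `Theorems.RadicialJung.CleanModels.LooseCleanForm p f G`.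

Docstring-only (§2): the cells of the g6 audit, see the memo — (A-abs) radicands `h ∈ k·K^p` along discrete arcs are CLEAN when a
coefficient field of `𝒪̂_v` contains `k` (hand proof, memo §3b); the index-gain recipe of CLASSA Lemma 7.1 FAILS on tower arcs over
imperfect `k` (memo §3a) but the worked tower example is clean through the ARITHMETIC regular parameter `π_N = ỹ^p - s̃` of the
inseparable centre (memo §3c); the two residual cells R1 («no coefficient field contains `k`») and R2 («mixed radicand, `k ⊆ C`») of
`stub_cleanLU3Defect` over imperfect `k` are OPEN with no specimen against them (memo §3d).  0 cards.  Nothing here is served to provers.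

§4 `ArcPotentialSteps` (rev 4): kernel certificates of the abstract cores of steps (P0), (P1), (P2), (P4) of lens-5 g7's
THEOREM P (memo §3g: lens-6's independent check found no gap) — `exists_val_sub_pow_eq_val_pow_of_noBestApprox`,
`le_of_derivation_apply_eq_pow_mul`, `not_mem_span_sup_sq_of_val_le_sq`, `exists_eq_pow_mul_of_mem_pow`; census support for
the 15917 provers (lens-5's lemma list L7, L2, L3, L5), counted 0.
-/

noncomputable section

set_option linter.dupNamespace false -- mandated namespace of this single-conjunct summit

open IsLocalRing

namespace Summit.ResolutionOfSingularities.ResolutionOfSingularities.Cruxes.DescentPerfectToAll.NegationLens6g6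

/-! ## §1 The two-sided normal form of the strict clean forms (2)/(3) (proved) -/

section NormalForm

variable {p : ℕ} [hp : Fact p.Prime] {R F : Type*} [CommRing R] [IsLocalRing R] [CommRing F]

/-- `δ`-step: if `s - c₀^p ∈ 𝔪 ∖ 𝔪²` for ONE `c₀`, then `s - c^p ∉ 𝔪²` for EVERY `c` — because `c^p - c₀^p = (c - c₀)^p`, `p`-th roots are
unique modulo the prime `𝔪`, and `𝔪^p ⊆ 𝔪²`.  (g5 `NegationLens6g5.form3_iff_of_mem`, re-proved.) [folklore] -/
theorem forall_sub_pow_not_mem_sq_of_form3 [CharP R p] {s c₀ : R} (h₁ : s - c₀ ^ p ∈ maximalIdeal R)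
    (h₂ : s - c₀ ^ p ∉ maximalIdeal R ^ 2) (c : R) : s - c ^ p ∉ maximalIdeal R ^ 2 := by
  intro hc
  have two_le : 2 ≤ p := hp.out.two_le
  have hdiff : c ^ p - c₀ ^ p ∈ maximalIdeal R := by
    have e : c ^ p - c₀ ^ p = (s - c₀ ^ p) - (s - c ^ p) := by ring
    rw [e]
    exact (maximalIdeal R).sub_mem h₁ (Ideal.pow_le_self two_ne_zero hc)
  have e₁ : (c - c₀) ^ p = c ^ p - c₀ ^ p := by rw [sub_pow_char]
  have hcc : c - c₀ ∈ maximalIdeal R := by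
    have h' : (c - c₀) ^ p ∈ maximalIdeal R := by rw [e₁]; exact hdiff
    exact (IsLocalRing.maximalIdeal.isMaximal R).isPrime.mem_of_pow_mem p h'
  have hsq : c ^ p - c₀ ^ p ∈ maximalIdeal R ^ 2 := by
    rw [← e₁]
    exact Ideal.pow_le_pow_right two_le (Ideal.pow_mem_pow hcc p)
  have e₂ : s - c₀ ^ p = (s - c ^ p) + (c ^ p - c₀ ^ p) := by ring
  exact h₂ (by rw [e₂]; exact (maximalIdeal R ^ 2).add_mem hc hsq)

omit hp in
/-- Form (2) gives the avoidance property trivially (`𝔪² ⊆ 𝔪`). [folklore] -/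
theorem forall_sub_pow_not_mem_sq_of_form2 {u : R} (h : ∀ c : R, u - c ^ p ∉ maximalIdeal R) (c : R) :
    u - c ^ p ∉ maximalIdeal R ^ 2 :=
  fun hc => h c (Ideal.pow_le_self two_ne_zero hc)

/-- **LEMMA A⁺.** If some preimage `s` of `G` avoids `R^p + 𝔪²` (`s - c^p ∉ 𝔪²` for every `c`), then `G` has loose clean form (2) or (3)
at `R` — form (3) if some `s - c^p` lies in `𝔪`, form (2) otherwise (then `s` is a unit whose residue is not a `p`-th power).  No case
analysis on the residue field is needed. [folklore] -/
theorem form2_or_form3_of_forall_sub_pow_not_mem_sq (f : R →+* F) {G : F} {s : R} (hG : G = f s)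
    (h : ∀ c : R, s - c ^ p ∉ maximalIdeal R ^ 2) :
    (∃ u : R, IsUnit u ∧ G = f u ∧ ∀ c : R, u - c ^ p ∉ maximalIdeal R) ∨
      (∃ s c : R, G = f s ∧ s - c ^ p ∈ maximalIdeal R ∧ s - c ^ p ∉ maximalIdeal R ^ 2) := by
  by_cases hex : ∃ c : R, s - c ^ p ∈ maximalIdeal R
  · obtain ⟨c, hc⟩ := hex
    exact Or.inr ⟨s, c, hG, hc, h c⟩
  · rw [not_exists] at hex
    refine Or.inl ⟨s, ?_, hG, hex⟩
    have h0 : s ∉ maximalIdeal R := by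
      have h0' := hex 0
      rwa [zero_pow hp.out.ne_zero, sub_zero] at h0'
    by_contra hu
    exact h0 ((IsLocalRing.mem_maximalIdeal s).mpr (mem_nonunits_iff.mpr hu))

/-- **The two-sided normal form** of the strict clean forms: (2) ∨ (3) at `R` for `G` ⟺ some preimage of `G` avoids `R^p + 𝔪²`.
[folklore] -/
theorem form2_or_form3_iff [CharP R p] (f : R →+* F) (G : F) :
    ((∃ u : R, IsUnit u ∧ G = f u ∧ ∀ c : R, u - c ^ p ∉ maximalIdeal R) ∨
      (∃ s c : R, G = f s ∧ s - c ^ p ∈ maximalIdeal R ∧ s - c ^ p ∉ maximalIdeal R ^ 2)) ↔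
      ∃ s : R, G = f s ∧ ∀ c : R, s - c ^ p ∉ maximalIdeal R ^ 2 := by
  constructor
  · rintro (⟨u, -, hG, hu⟩ | ⟨s, c₀, hG, h₁, h₂⟩)
    · exact ⟨u, hG, forall_sub_pow_not_mem_sq_of_form2 hu⟩
    · exact ⟨s, hG, forall_sub_pow_not_mem_sq_of_form3 h₁ h₂⟩
  · rintro ⟨s, hG, h⟩
    exact form2_or_form3_of_forall_sub_pow_not_mem_sq f hG h

/-- Packaged: avoidance of `R^p + 𝔪²` by a preimage gives `LooseCleanForm p f G` (second or third disjunct). [folklore] -/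
theorem looseCleanForm_of_forall_sub_pow_not_mem_sq (f : R →+* F) {G : F} {s : R} (hG : G = f s)
    (h : ∀ c : R, s - c ^ p ∉ maximalIdeal R ^ 2) :
    Theorems.RadicialJung.CleanModels.LooseCleanForm p f G := by
  unfold Theorems.RadicialJung.CleanModels.LooseCleanForm
  exact Or.inr (form2_or_form3_of_forall_sub_pow_not_mem_sq f hG h)

/-- Contrapositive reading used by the negation lens: if `G = f s` has NEITHER form (2) NOR form (3) at `R` through `f`, then EVERY
preimage `s'` of `G` meets `R^p + 𝔪²` (`s' - c^p ∈ 𝔪²` for some `c`).  For an injective `f` (a subring of the function field) this is the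
single obstruction «`ds' ⊗ 1 = 0`» that a persistent-uncleanness specimen must exhibit at every model point along the valuation
(besides excluding the toric form (1)). [folklore] -/
theorem exists_sub_pow_mem_sq_of_not_form23 (f : R →+* F) {G : F}
    (hno : ¬ ((∃ u : R, IsUnit u ∧ G = f u ∧ ∀ c : R, u - c ^ p ∉ maximalIdeal R) ∨
      (∃ s c : R, G = f s ∧ s - c ^ p ∈ maximalIdeal R ∧ s - c ^ p ∉ maximalIdeal R ^ 2)))
    {s' : R} (hG : G = f s') : ∃ c : R, s' - c ^ p ∈ maximalIdeal R ^ 2 := by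
  by_contra hc
  rw [not_exists] at hc
  exact hno (form2_or_form3_of_forall_sub_pow_not_mem_sq f hG hc)

end NormalForm

/-! ## §3 Perfect-closure DESCENT of clean LU — the residue of the imperfect door, typed (memo rev 3 §3f); census, counted 0

The two definitions `CleanConclusion`, `CleanLUAtDimOver` are VERBATIM copies of g5's (`NegationLens6g5.lean` §2; crux workfiles are
not importable on the farm), so that `ViaCpFrame.CleanLUAtDim n = ∀ p, p.Prime → ∀ k [Field k] [CharP k p], CleanLUAtDimOver p k n`
binder for binder.  NEW here: `CleanLUAtDimPerfect` (the perfect-ground-field case, perfectness stated elementarily as in lens-5's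
census), `CleanLUPerfectDescent` (clean LU at local dimension `n` DESCENDS from a perfect purely-inseparable extension of the ground
field — the statement memo §3f isolates as the residue of the residually-finite imperfect door: CLASSA(rational arcs) upstairs is
lens-5's, the descent is what nobody has), and the kernel-checked ASSEMBLY `cleanLUAtDimOver_of_perfect_of_descent`:
perfect case ∧ perfect-closure descent ⟹ the all-fields stub at local dimension `n` (via Mathlib's `PerfectClosure k p`).
No mechanism is proposed for the descent (the derivation/foliation mechanism is the critic-guarded dead slug «constant-foliation-descent»;
memo §3f (c) records why the descent is not formal).  Not a line, not a card.
rev 4 NOTE (memo §3g): lens-5 g7's THEOREM P (pending critic triage; lens-6 found no gap) closes class (A) along discrete arcs over EVERY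
field with no descent at all, so the content of `CleanLUPerfectDescent` lies in classes (B)/(C) and principalization, not in the arc class. -/

section PerfectDescent

open Literature.AlgebraicGeometry.Resolution

/-- verbatim copy of g5 `NegationLens6g5.CleanConclusion` (= the conclusion of `ViaCpFrame.CleanLUAtDim` at the data
`(p, k, K, O, A, g₀)`): some finitely generated `A ⊆ A' ⊆ O`, regular at the centre of `O`, carries a non-trivial loosely clean
representative `∑ c_j^p g₀^j` of the `K^p`-line of `g₀`. [folklore] -/
def CleanConclusion (p : ℕ) (k K : Type) [Field k] [Field K] [Algebra k K] (O : ValuationSubring K)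
    (A : Subalgebra k K) (g₀ : K) : Prop :=
  ∃ (A' : Subalgebra k K), A'.toSubring ≤ O.toSubring ∧ A ≤ A' ∧ A'.FG ∧
    ∃ (_ : IsRegularLocalRing (locAtCentre A'.toSubring O)) (c : Fin p → K),
      (∃ j : Fin p, (j : ℕ) ≠ 0 ∧ c j ≠ 0) ∧
      ((∃ (d m : ℕ) (hmd : m ≤ d) (t : Fin d → ↥(locAtCentre A'.toSubring O)) (a : Fin m → ℕ)
          (u : ↥(locAtCentre A'.toSubring O)), IsUnit u ∧
          Ideal.span (Set.range t) = IsLocalRing.maximalIdeal ↥(locAtCentre A'.toSubring O) ∧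
          ringKrullDim ↥(locAtCentre A'.toSubring O) = (d : WithBot ℕ∞) ∧ 0 < m ∧ (∀ i, ¬ p ∣ a i) ∧
          (∑ j : Fin p, c j ^ p * g₀ ^ (j : ℕ)) =
            (u : K) * ∏ i : Fin m, ((t (Fin.castLE hmd i) : ↥(locAtCentre A'.toSubring O)) : K) ^ (a i)) ∨
        (∃ u : ↥(locAtCentre A'.toSubring O), IsUnit u ∧ (∑ j : Fin p, c j ^ p * g₀ ^ (j : ℕ)) = (u : K) ∧
          ∀ c' : ↥(locAtCentre A'.toSubring O), u - c' ^ p ∉ IsLocalRing.maximalIdeal ↥(locAtCentre A'.toSubring O)) ∨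
        (∃ s c' : ↥(locAtCentre A'.toSubring O), (∑ j : Fin p, c j ^ p * g₀ ^ (j : ℕ)) = (s : K) ∧
          s - c' ^ p ∈ IsLocalRing.maximalIdeal ↥(locAtCentre A'.toSubring O) ∧
          s - c' ^ p ∉ IsLocalRing.maximalIdeal ↥(locAtCentre A'.toSubring O) ^ 2))

/-- verbatim copy of g5 `NegationLens6g5.CleanLUAtDimOver`: clean LU at centres of local dimension `n`, ground field FIXED to `k`.
[folklore] -/
def CleanLUAtDimOver (p : ℕ) (k : Type) [Field k] (n : ℕ) : Prop :=
  ∀ (K : Type) [Field K] [Algebra k K] (O : ValuationSubring K) (A : Subalgebra k K),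
    A.toSubring ≤ O.toSubring → A.FG → IsFractionRing A K →
    IsRegularLocalRing (locAtCentre A.toSubring O) →
    ringKrullDim (locAtCentre A.toSubring O) = (n : WithBot ℕ∞) →
    ∀ g₀ : K, (∀ c : K, c ^ p ≠ g₀) → CleanConclusion p k K O A g₀

/-- **Clean LU at local dimension `n` over every PERFECT ground field of characteristic `p`** (perfectness stated elementarily,
`∀ a, ∃ b, b ^ p = a`, as in lens-5's `CleanLUDefectArcAt`).  Over perfect `k`, class (A) of the `n = 3` stub is lens-5's CLASSA rev 2;
classes (B), (C) remain open there.  [folklore] -/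
def CleanLUAtDimPerfect (p n : ℕ) : Prop :=
  ∀ (k : Type) [Field k] [CharP k p], (∀ a : k, ∃ b : k, b ^ p = a) → CleanLUAtDimOver p k n

/-- **Perfect-closure DESCENT of clean LU at local dimension `n`** (memo rev 3 §3f, typed; OPEN, no mechanism claimed): for every field
`k` of characteristic `p` and every field extension `k'/k` that is PERFECT and PURELY INSEPARABLE over `k` (every `a ∈ k'` has some
`a^{p^m} ∈ k`; i.e. `k'` is a perfect closure of `k`), clean LU over `k'` implies clean LU over `k`.  Strictly weaker than the all-fields
stub `∀ k, CleanLUAtDimOver p k n`; with `CleanLUAtDimPerfect` it reassembles the stub (`cleanLUAtDimOver_of_perfect_of_descent`).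
Content (memo §3f): a `k`-instance whose base change to a FINITE purely inseparable `k₁ ⊆ k'` is cleaned upstairs must be cleaned
downstairs through (a) non-comparable model towers, (b) line-vs-plane representatives (`K₁^p(g₀) ∩ K ⊋ K^p(g₀)`), (c) no abstract
descent of regularity along purely inseparable extensions; instances with `K/k` inseparable are in scope exactly as in the stub.
[folklore] -/
def CleanLUPerfectDescent (p n : ℕ) : Prop :=
  ∀ (k : Type) [Field k] [CharP k p] (k' : Type) [Field k'] [Algebra k k'],
    (∀ a : k', ∃ b : k', b ^ p = a) →
    (∀ a : k', ∃ m : ℕ, a ^ p ^ m ∈ Set.range (algebraMap k k')) →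
    CleanLUAtDimOver p k' n → CleanLUAtDimOver p k n

/-- **Assembly (kernel-checked): perfect case ∧ perfect-closure descent ⟹ clean LU at local dimension `n` over EVERY field of
characteristic `p`** — instantiate the descent at Mathlib's `PerfectClosure k p` (perfect: `surjective_frobenius`; purely inseparable:
`PerfectClosure.iterate_frobenius_mk`).  So the imperfect door of the `(β)`-family stubs splits as «perfect ground fields» (lens-5's
territory) ∧ «descent from the perfect closure» (the residue memo §3f names); counted 0. [folklore] -/
theorem cleanLUAtDimOver_of_perfect_of_descent (p n : ℕ) [Fact p.Prime]
    (hperf : CleanLUAtDimPerfect p n) (hdesc : CleanLUPerfectDescent p n)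
    (k : Type) [Field k] [CharP k p] : CleanLUAtDimOver p k n := by
  letI : Algebra k (PerfectClosure k p) := (PerfectClosure.of k p).toAlgebra
  have hsurj : ∀ a : PerfectClosure k p, ∃ b : PerfectClosure k p, b ^ p = a := fun a => by
    obtain ⟨b, hb⟩ := surjective_frobenius (PerfectClosure k p) p a
    exact ⟨b, by simpa only [frobenius_def] using hb⟩
  refine hdesc k (PerfectClosure k p) hsurj (fun a => ?_) (hperf (PerfectClosure k p) hsurj)
  induction a using PerfectClosure.induction_on with
  | h x =>
    obtain ⟨m, y⟩ := x
    refine ⟨m, y, ?_⟩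
    have h := PerfectClosure.iterate_frobenius_mk k p m y
    rw [iterate_frobenius] at h
    rw [h]
    rfl

/-- The all-fields statement at local dimension `n` is, conversely, trivially the conjunction (both pieces are special cases /
weakenings of it). [folklore] -/
theorem perfect_and_descent_of_cleanLUAtDimOver (p n : ℕ)
    (h : ∀ (k : Type) [Field k] [CharP k p], CleanLUAtDimOver p k n) :
    CleanLUAtDimPerfect p n ∧ CleanLUPerfectDescent p n :=
  ⟨fun k _ _ _ => h k, fun k _ _ _ _ _ _ _ _ => h k⟩

end PerfectDescent

section ArcPotentialSteps

/-! ## §4 (rev 4) Kernel certificates of four steps of lens-5 g7's THEOREM P (memo §3g; census support, counted 0)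
Abstract cores of (P0), (P1), (P2), (P4) of `CLASSA-allfields-potential-lens5.md` (e709ae1b8c5f), stated over Mathlib
`Valuation` / `Derivation ℤ R R` / ideals so that the 15917 provers can instantiate them on the lead's `R : ℕ → Subring K`
package (`hdefect` there is literally the hypothesis of `exists_val_sub_pow_eq_val_pow_of_noBestApprox` with `v = O.valuation`).
Nothing here is 3-dimensional and nothing mentions residue fields — which is the point of THEOREM P. -/

/-- (P0), direct form: if `v (g₀ - c₀^p)` is NOT the value of a `p`-th power, then `c₀` is a best `p`-th-power
approximation of `g₀`. [folklore] -/
theorem val_sub_pow_le_of_forall_ne_val_pow {K : Type*} [Field K] (p : ℕ) [Fact p.Prime] [CharP K p]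
    {Γ₀ : Type*} [LinearOrderedCommGroupWithZero Γ₀] (v : Valuation K Γ₀) (g₀ c₀ : K)
    (hc₀ : ∀ d : K, v (g₀ - c₀ ^ p) ≠ v (d ^ p)) (c : K) :
    v (g₀ - c₀ ^ p) ≤ v (g₀ - c ^ p) := by
  have key : g₀ - c ^ p = (g₀ - c₀ ^ p) + (c₀ - c) ^ p := by
    rw [sub_pow_char (R := K) (p := p) c₀ c]; ring
  by_contra hlt
  rw [not_le] at hlt
  rcases lt_trichotomy (v ((c₀ - c) ^ p)) (v (g₀ - c₀ ^ p)) with h | h | h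
  · -- both summands... v(B) < v(A): then v(A + B) = v A
    have := Valuation.map_add_eq_of_lt_left v h
    rw [← key] at this
    exact absurd this (ne_of_lt hlt)
  · exact hc₀ (c₀ - c) h.symm
  · have := Valuation.map_add_eq_of_lt_right v h
    rw [← key] at this
    -- v (g₀ - c^p) = v B > v A, contradicts hlt : v(g₀ - c^p) < v A
    exact absurd (this ▸ h) (not_lt.mpr hlt.le)

/-- (P0) of THEOREM P: under `hdefect` (no best `p`-th-power approximation) EVERY value `v (g₀ - c^p)` is the value of a
`p`-th power (for a discrete rank-one `v` with `v(π)` generating: `∈ p·ℤ·v(π)`). [folklore] -/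
theorem exists_val_sub_pow_eq_val_pow_of_noBestApprox {K : Type*} [Field K] (p : ℕ) [Fact p.Prime] [CharP K p]
    {Γ₀ : Type*} [LinearOrderedCommGroupWithZero Γ₀] (v : Valuation K Γ₀) (g₀ : K)
    (hdefect : ∀ f₀ : K, ∃ f₁ : K, v (g₀ - f₁ ^ p) < v (g₀ - f₀ ^ p)) (c : K) :
    ∃ d : K, v (g₀ - c ^ p) = v (d ^ p) := by
  by_contra H
  rw [not_exists] at H
  obtain ⟨c', hc'⟩ := hdefect c
  exact absurd (val_sub_pow_le_of_forall_ne_val_pow p v g₀ c H c') (not_le.mpr hc')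

/-- (P1) core of THEOREM P: if a derivation `D` with `π ∣ D π` sends `π^a · F` to `π^e · u` with `π ∤ u`, then `a ≤ e`
(Leibniz: `D (π^a F) ∈ π^a R`).  Instantiated with `D = E_N = π^{N-N₀} E` on `R N`, `f = h - c^p = π^a F`, `E_N f = E_N h = π^{e_N} u₀`,
it gives `ord_π (h - c^p) ≤ e_N`, the inequality that makes the potential `Π_N = e_N - a_N` a natural number. [folklore] -/
theorem le_of_derivation_apply_eq_pow_mul {R : Type*} [CommRing R] [IsDomain R] (D : Derivation ℤ R R)
    {π F u : R} {a e : ℕ} (hπ : π ≠ 0) (hDπ : π ∣ D π) (hD : D (π ^ a * F) = π ^ e * u)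
    (hu : ¬ π ∣ u) : a ≤ e := by
  by_contra h
  rw [not_le] at h
  have ha : 1 ≤ a := Nat.one_le_of_lt h
  have hdiv : π ^ a ∣ D (π ^ a * F) := by
    rw [Derivation.leibniz, Derivation.leibniz_pow]
    refine dvd_add ?_ ?_
    · exact ⟨D F, by rw [smul_eq_mul]⟩
    · obtain ⟨w, hw⟩ := hDπ
      refine ⟨F * (a * w), ?_⟩
      simp only [smul_eq_mul, nsmul_eq_mul, hw]
      have : π ^ a = π ^ (a - 1) * π := by
        rw [← pow_succ, Nat.sub_add_cancel ha]
      rw [this]; ring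
  rw [hD] at hdiv
  obtain ⟨w, hw⟩ := hdiv
  have : π ^ e * u = π ^ e * (π ^ (a - e) * w) := by
    rw [hw, ← mul_assoc, ← pow_add, Nat.add_sub_cancel' h.le]
  have hu' : u = π ^ (a - e) * w := mul_left_cancel₀ (pow_ne_zero e hπ) this
  apply hu
  refine ⟨π ^ (a - e - 1) * w, ?_⟩
  rw [hu', ← mul_assoc, ← pow_succ', Nat.sub_add_cancel (Nat.sub_pos_of_lt h)]

/-- (P4) core of THEOREM P, ideal form: `𝔪_N · R_{N+1} = π · R_{N+1}` ⇒ `𝔪_N^b · R_{N+1} = π^b · R_{N+1}`. [folklore] -/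
theorem map_pow_eq_span_singleton_pow {R S : Type*} [CommRing R] [CommRing S] (f : R →+* S) (I : Ideal R) (π : S)
    (h : I.map f = Ideal.span {π}) (b : ℕ) : (I ^ b).map f = Ideal.span {π ^ b} := by
  rw [Ideal.map_pow, h, Ideal.span_singleton_pow]

/-- (P4) core of THEOREM P, element form: `F ∈ 𝔪_N^b` ⇒ `F = π^b · w` in `R_{N+1}`; with `f = π^a F` this is
`ord_π^{R_{N+1}} (f) ≥ a + ord_{𝔪_N} (F)`. [folklore] -/
theorem exists_eq_pow_mul_of_mem_pow {R S : Type*} [CommRing R] [CommRing S] (f : R →+* S) (I : Ideal R) (π : S)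
    (h : I.map f = Ideal.span {π}) {b : ℕ} {F : R} (hF : F ∈ I ^ b) : ∃ w : S, f F = π ^ b * w := by
  have : f F ∈ Ideal.span {π ^ b} := by
    rw [← map_pow_eq_span_singleton_pow f I π h b]; exact Ideal.mem_map_of_mem f hF
  obtain ⟨w, hw⟩ := Ideal.mem_span_singleton'.mp this
  exact ⟨w, by rw [← hw, mul_comm]⟩


/-- (P2) core of THEOREM P: in a local ring `R` dominated by a valuation (`v ≤ 1` on `R`), with `π` of minimal value in the
maximal ideal, an element `F ∉ 𝔪²` whose value is at most `v(π)²` (additively: `v(F) ≥ 2·v(π)`, which is `v(F) = m - a ≥ 2`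
in (P2)) is independent of `π` modulo `𝔪²`: `F ∉ (π) + 𝔪²`.  Hence `(π, F)` extends to a regular system of parameters when
`R` is regular, and (P2) reads off loose form (1) (`p ∤ a`) or (3) (`p ∣ a`). [folklore] -/
theorem not_mem_span_sup_sq_of_val_le_sq {R K Γ₀ : Type*} [CommRing R] [IsLocalRing R] [Field K]
    [LinearOrderedCommGroupWithZero Γ₀] (v : Valuation K Γ₀) (ι : R →+* K)
    (hdom : ∀ x : R, v (ι x) ≤ 1) (π F : R) (hπ0 : v (ι π) ≠ 0) (hπ1 : v (ι π) < 1)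
    (hmin : ∀ x ∈ maximalIdeal R, v (ι x) ≤ v (ι π)) (hF2 : F ∉ (maximalIdeal R) ^ 2)
    (hvF : v (ι F) ≤ v (ι π) ^ 2) :
    F ∉ Ideal.span {π} ⊔ (maximalIdeal R) ^ 2 := by
  intro hmem
  rw [Ideal.mem_span_singleton_sup] at hmem
  obtain ⟨lam, q, hq, hFq⟩ := hmem
  have hJ : ∀ s ∈ (maximalIdeal R) ^ 2, v (ι s) ≤ v (ι π) ^ 2 := by
    intro s hs
    rw [pow_two] at hs
    refine Submodule.mul_induction_on hs ?_ ?_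
    · intro m hm n hn
      rw [map_mul, Valuation.map_mul, pow_two]
      exact mul_le_mul' (hmin m hm) (hmin n hn)
    · intro x y hx hy
      rw [map_add]
      exact (Valuation.map_add v _ _).trans (max_le hx hy)
  have hunit : ∀ u : Rˣ, v (ι (u : R)) = 1 := by
    intro u
    have h1 : v (ι (u : R)) * v (ι (↑u⁻¹ : R)) = 1 := by
      rw [← Valuation.map_mul, ← map_mul, Units.mul_inv, map_one, Valuation.map_one]
    refine le_antisymm (hdom _) ?_
    calc (1 : Γ₀) = v (ι (u : R)) * v (ι (↑u⁻¹ : R)) := h1.symm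
      _ ≤ v (ι (u : R)) * 1 := mul_le_mul_right (hdom _) _
      _ = v (ι (u : R)) := mul_one _
  have hπm : π ∈ maximalIdeal R := by
    rw [mem_maximalIdeal, mem_nonunits_iff]
    rintro ⟨u, rfl⟩
    exact absurd (hunit u) (ne_of_lt hπ1)
  by_cases hlam : lam ∈ maximalIdeal R
  · apply hF2
    rw [← hFq, pow_two]
    exact Ideal.add_mem _ (Ideal.mul_mem_mul hlam hπm) (by rw [← pow_two]; exact hq)
  · have hlamu : IsUnit lam := by
      rw [mem_maximalIdeal, mem_nonunits_iff, not_not] at hlam; exact hlam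
    obtain ⟨u, rfl⟩ := hlamu
    have hval : v (ι ((u : R) * π)) = v (ι π) := by
      rw [map_mul, Valuation.map_mul, hunit u, one_mul]
    have hFq' : ι ((u : R) * π) = ι F + -(ι q) := by
      rw [← hFq, map_add]; ring
    have hlt2 : v (ι π) ^ 2 < v (ι π) := by
      rw [pow_two]
      calc v (ι π) * v (ι π) < 1 * v (ι π) := mul_lt_mul_of_pos_right hπ1 (zero_lt_iff.mpr hπ0)
        _ = v (ι π) := one_mul _
    have hle : v (ι F + -(ι q)) ≤ v (ι π) ^ 2 :=
      (Valuation.map_add v _ _).trans (max_le hvF (by rw [Valuation.map_neg]; exact hJ q hq))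
    rw [← hFq', hval] at hle
    exact absurd (hle.trans_lt hlt2) (lt_irrefl _)


end ArcPotentialSteps

end Summit.ResolutionOfSingularities.ResolutionOfSingularities.Cruxes.DescentPerfectToAll.NegationLens6g6

end
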